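import Summits.ValiantsHypothesis.ValiantsHypothesis.Theorems.KPlusLogSqLawWindowDescartesOneSided
import Summits.ValiantsHypothesis.ValiantsHypothesis.Theorems.KPlusLogSqLawLiftingNewtonWindows

/-!
# The window Descartes rule — the degenerate window `p = q` and the `p ≤ q` packaging

Seat val-sym-lift-p4 (g2), cell `pub-symmetroid`, 2026-08-26; sequel of `…WindowDescartesOneSided` (GAP-LIFT §7).  Two small
completions that make the window rule total along a chain of dominance points:
* `eval_ne_zero_of_dominant_ends` — if the SAME monomial `X^w` dominates `f` at `a` and at `b` (`0 < a ≤ b`), then `f` has no zero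
  on `[a, b]`: dominance transports to the whole segment by convexity in `log x`
  (`ExactPatchwork.sum_mul_pow_lt_of_endpoints`, val-sym-lift-p2 g3) and decides the sign of `f`
  (`ExactPatchwork.mul_eval_pos_of_dominant`);
* `window_descartes_card_roots_of_le` — the distinct-zero form of the window rule for `p ≤ q` (the case `p = q` contributing `0`),
  so that consecutive dominance points of a chain `x₀ < … < xₙ` with non-decreasing dominant indices can be fed in without a case
  split; `dominant_support_of_dominant_range` converts the `Finset.range`-form of the dominance hypothesis used in this file series
  into the `support`-form of `…LiftingNewtonWindows`.
HONEST FRAMING: theorems about real polynomials; nothing here asserts `WeakLifting`, `TropicalB`, Conjecture B, `MatrixDescartes`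
(stmt-ValiantsHypothesis-18050) or anything on VP ≠ VNP. [this file's theorems]
-/

set_option linter.dupNamespace false
set_option autoImplicit false

namespace Summit.ValiantsHypothesis.ValiantsHypothesis.Theorems.KPlusLogSqLaw.WindowDescartes

open Polynomial

section Window

variable {a b : ℝ}

/-- the `range`-form of archimedean dominance implies the `support`-form. -/
theorem dominant_support_of_dominant_range (f : ℝ[X]) {N : ℕ} (hN : f.natDegree ≤ N) {x : ℝ} (hx : 0 ≤ x) {w : ℕ}
    (h : ∑ s ∈ (Finset.range (N + 1)).erase w, |f.coeff s| * x ^ s < |f.coeff w| * x ^ w) :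
    ∑ s ∈ f.support.erase w, |f.coeff s| * x ^ s < |f.coeff w| * x ^ w := by
  refine lt_of_le_of_lt (Finset.sum_le_sum_of_subset_of_nonneg (fun s hs => ?_)
    (fun s _ _ => mul_nonneg (abs_nonneg _) (pow_nonneg hx _))) h
  rw [Finset.mem_erase] at hs ⊢
  refine ⟨hs.1, Finset.mem_range.mpr (Nat.lt_succ_of_le ((le_natDegree_of_mem_supp _ hs.2).trans hN))⟩

/-- **the degenerate window**: if the same monomial `X^w` dominates `f` at `a` and at `b`, `0 < a ≤ b`, then `f x ≠ 0` for all
`x ∈ [a, b]` (convexity transport of dominance, val-sym-lift-p2 g3's `ExactPatchwork.sum_mul_pow_lt_of_endpoints`). -/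
theorem eval_ne_zero_of_dominant_ends (f : ℝ[X]) {N : ℕ} (hN : f.natDegree ≤ N) (ha : 0 < a) {w : ℕ}
    (hda : ∑ s ∈ (Finset.range (N + 1)).erase w, |f.coeff s| * a ^ s < |f.coeff w| * a ^ w)
    (hdb : ∑ s ∈ (Finset.range (N + 1)).erase w, |f.coeff s| * b ^ s < |f.coeff w| * b ^ w)
    {x : ℝ} (hax : a ≤ x) (hxb : x ≤ b) : f.eval x ≠ 0 := by
  have hx : 0 < x := lt_of_lt_of_le ha hax
  have hdx : ∑ s ∈ (Finset.range (N + 1)).erase w, |f.coeff s| * x ^ s < |f.coeff w| * x ^ w :=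
    ExactPatchwork.sum_mul_pow_lt_of_endpoints _ (fun s => |f.coeff s|) (fun s => abs_nonneg _) w ha hax hxb hda hdb
  have hpos := ExactPatchwork.mul_eval_pos_of_dominant f hx (dominant_support_of_dominant_range f hN hx.le hdx)
  intro h0
  rw [h0, mul_zero] at hpos
  exact lt_irrefl _ hpos

/-- **The window Descartes rule, distinct-zero form, for `p ≤ q`**: the number of distinct zeros of `f` in `(a, b)` is at most
`V(coeff f p, …, coeff f q)`; for `p = q` there is none. -/
theorem window_descartes_card_roots_of_le (f : ℝ[X]) {N : ℕ} (hN : f.natDegree ≤ N) (ha : 0 < a) (hab : a < b)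
    {p q : ℕ} (hpq : p ≤ q)
    (hda : ∑ s ∈ (Finset.range (N + 1)).erase p, |f.coeff s| * a ^ s < |f.coeff p| * a ^ p)
    (hdb : ∑ s ∈ (Finset.range (N + 1)).erase q, |f.coeff s| * b ^ s < |f.coeff q| * b ^ q) :
    ((f.roots.toFinset).filter (fun x => a < x ∧ x < b)).card ≤ sgnChanges (slist (fun i => f.coeff (p + i)) (q - p)) := by
  rcases hpq.eq_or_lt with rfl | hpq'
  · have hcp : f.coeff p ≠ 0 := by
      intro h0; rw [h0, abs_zero, zero_mul] at hda
      exact absurd hda (not_lt.mpr (Finset.sum_nonneg fun s _ => mul_nonneg (abs_nonneg _) (pow_nonneg ha.le _)))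
    have hf : f ≠ 0 := fun h => hcp (by rw [h, coeff_zero])
    have hnone : (f.roots.toFinset).filter (fun x => a < x ∧ x < b) = ∅ := by
      refine Finset.filter_eq_empty_iff.mpr fun x hx hx' => ?_
      rw [Multiset.mem_toFinset, mem_roots hf] at hx
      exact eval_ne_zero_of_dominant_ends f hN ha hda hdb hx'.1.le hx'.2.le hx
    rw [hnone, Finset.card_empty]
    exact Nat.zero_le _
  · exact window_descartes_card_roots f hN ha hab hpq' hda hdb

/-- **Chain form along consecutive dominance points** (stated for one step, to be summed by the user): the zeros of `f` in
`(x₁, x₂]` for dominance points `x₁ < x₂` with dominant indices `w₁ ≤ w₂` number at most `V(coeff f w₁, …, coeff f w₂)` — the right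
endpoint is never a zero. -/
theorem window_descartes_card_roots_Ioc (f : ℝ[X]) {N : ℕ} (hN : f.natDegree ≤ N) (ha : 0 < a) (hab : a < b)
    {p q : ℕ} (hpq : p ≤ q)
    (hda : ∑ s ∈ (Finset.range (N + 1)).erase p, |f.coeff s| * a ^ s < |f.coeff p| * a ^ p)
    (hdb : ∑ s ∈ (Finset.range (N + 1)).erase q, |f.coeff s| * b ^ s < |f.coeff q| * b ^ q) :
    ((f.roots.toFinset).filter (fun x => a < x ∧ x ≤ b)).card ≤ sgnChanges (slist (fun i => f.coeff (p + i)) (q - p)) := by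
  have hb : 0 < b := ha.trans hab
  have hfb : f.eval b ≠ 0 := by
    have hpos := ExactPatchwork.mul_eval_pos_of_dominant f hb (dominant_support_of_dominant_range f hN hb.le hdb)
    intro h0; rw [h0, mul_zero] at hpos; exact lt_irrefl _ hpos
  have hcq : f.coeff q ≠ 0 := by
    intro h0; rw [h0, abs_zero, zero_mul] at hdb
    exact absurd hdb (not_lt.mpr (Finset.sum_nonneg fun s _ => mul_nonneg (abs_nonneg _) (pow_nonneg hb.le _)))
  have hf : f ≠ 0 := fun h => hcq (by rw [h, coeff_zero])
  have heq : (f.roots.toFinset).filter (fun x => a < x ∧ x ≤ b) = (f.roots.toFinset).filter (fun x => a < x ∧ x < b) := by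
    refine Finset.filter_congr fun x hx => ?_
    rw [Multiset.mem_toFinset, mem_roots hf] at hx
    refine ⟨fun h => ⟨h.1, lt_of_le_of_ne h.2 fun hxb => hfb (hxb ▸ hx)⟩, fun h => ⟨h.1, h.2.le⟩⟩
  rw [heq]
  exact window_descartes_card_roots_of_le f hN ha hab hpq hda hdb

end Window

end Summit.ValiantsHypothesis.ValiantsHypothesis.Theorems.KPlusLogSqLaw.WindowDescartes
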